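import Summits.ABC.IUTFork.DAGL4t
import Summits.ABC.IUTFork.DAGL4v
import Summits.ABC.IUTFork.DAGL5b
import Summits.ABC.IUTFork.DAGXu

/-!
# Kernel DAG index — witness UPGRADE part ze (GENERATED by abc-iut-c312-2 gen 7 `work/gen_index.py upgrade` @2026-08-27T13:07Z from HOME/plan/DAG.tsv
(regenerated 2026-08-27T13:03:04Z); spec v1.3 §2(c) "`_holds` iff the DAG row is discharged", §5 "re-file when nodes change status")

THIS FILE PROVES NOTHING NEW AND ASSERTS NOTHING. For 4 nodes ALREADY INDEXED with a partial witness `N_<id>_part` (their DAG row was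
`landed(p…)` when indexed) whose row is NOW `discharged(p…)`, it adds the discharge witness `N_<id>_holds : N_<id> := N_<id>_part` BY NAME —
the node statement `N_<id>` is untouched (append-only across files: nothing landed is redefined). Nothing here says abc is proved or refuted
or takes a side on [IUTchIII] Cor 3.12. typed ≠ discharged; indexed ≠ endorsed.
-/

namespace Summit.ABC.IUTFork.DAG

/-- [node AbsTopIII:Cor5.5(iii) · L4/D1 · DAG status discharged(p526318+p525688+p518155+p515241+p510103+p485225+p488455+p458638)] discharge witness of `N_AbsTopIII_Cor5_5_iii'` (indexed in `DAGXu` with `_part` while the row was landed; now discharged, p526318): BY NAME; proves nothing new. -/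
theorem N_AbsTopIII_Cor5_5_iii'_holds : N_AbsTopIII_Cor5_5_iii' := N_AbsTopIII_Cor5_5_iii'_part

/-- [node AbsTopIII:Cor5.5(v) · L4/D1 · DAG status discharged(p425490)] discharge witness of `N_AbsTopIII_Cor5_5_v` (indexed in `DAGL4t` with `_part` while the row was landed; now discharged, p425490): BY NAME; proves nothing new. -/
theorem N_AbsTopIII_Cor5_5_v_holds : N_AbsTopIII_Cor5_5_v := N_AbsTopIII_Cor5_5_v_part

/-- [node IUTchI:Cor5.3(iii) · L5/D2 · DAG status discharged(p520897+p523255+p525809+p526558)] discharge witness of `N_IUTchI_Cor5_3_iii` (indexed in `DAGL5b` with `_part` while the row was landed; now discharged, p520897): BY NAME; proves nothing new. -/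
theorem N_IUTchI_Cor5_3_iii_holds : N_IUTchI_Cor5_3_iii := N_IUTchI_Cor5_3_iii_part

/-- [node AbsTopI:Lem4.5(ii) · L4/D1 · DAG status discharged(p406539)] discharge witness of `N_AbsTopI_Lem4_5_ii` (indexed in `DAGL4v` with `_part` while the row was landed; now discharged, p406539): BY NAME; proves nothing new. -/
theorem N_AbsTopI_Lem4_5_ii_holds : N_AbsTopI_Lem4_5_ii := N_AbsTopI_Lem4_5_ii_part

end Summit.ABC.IUTFork.DAG
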